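import Literature.AlgebraicGeometry.Frobenioids.IsotropicFrobenioid
import Mathlib.CategoryTheory.Adjunction.Basic
import HarnessLib

/-!
# Frobenioids I, Proposition 1.9 (v), part 3: the isotropification functor

Mochizuki, *The geometry of Frobenioids I: the general theory*, Kyushu J. Math. **62** (2008)
293–400, §1, Proposition 1.9 (v) and its proof, kurims text pp. 32–33
[cite: MochizukiFrdI2008, Prop. 1.9(v)]:

> "Moreover, the functor `C → C^istr` that assigns to an object `A ∈ Ob(C)` with isotropic hull
> `A → A^istr` the object `A^istr` and to a morphism of objects `A → B` with isotropic hulls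
> `A → A^istr`, `B → B^istr` the induced [i.e., by the definition of an "isotropic hull"!]
> morphism `A^istr → B^istr` forms a left adjoint to the inclusion functor `C^istr ↪ C`, through
> which the functor `C → F_Φ` factors. We shall refer to this functor as the isotropification
> functor. The restriction of the isotropification functor to `C^istr` is isomorphic to the
> identity functor. Finally, the isotropification functor preserves morphisms of Frobenius type,
> Frobenius degrees, pre-steps, pull-back morphisms, base-isomorphisms, base-FSM-morphisms,
> base-identity endomorphisms, Div-identity endomorphisms, isometries, co-angular morphisms, and
> LB-invertible morphisms".

Everything is PROVED (p. 33: "immediate from the definition of an isotropic hull … Remark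
1.1.1 … Proposition 1.4, (i) … Proposition 1.4, (ii)").

Renderings (recorded for the referee). The isotropification functor is built from CHOSEN isotropic
hulls (Def. 1.3 (vii)(a); any other choice gives an isomorphic functor). "through which `C → F_Φ`
factors" ↦ an ISOMORPHISM of functors `F ≅ isotropification ⋙ (C^istr → F_Φ)` whose components
are the images of the hulls (isometric pre-steps of degree one, hence isomorphisms of `F_Φ`); an
equality of functors is not asserted by the text and does not hold on the nose.
No statement of the paper is strengthened.
-/

namespace Literature.AlgebraicGeometry.Frobenioids

open CategoryTheory Opposite

universe w v v' u u'

namespace PreFrobenioid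

variable {D : Type u} [Category.{v} D] {Φ : Dᵒᵖ ⥤ CommMonCat.{w}}
  {C : Type u'} [Category.{v'} C] {F : C ⥤ ElemFrobenioid Φ}

/-! ### The isotropification functor -/

/-- The arrow `A^istr → B^istr` induced by `f : A → B` "[by the definition of an isotropic hull]".
[cite: MochizukiFrdI2008, Prop. 1.9(v) p.32] -/
noncomputable def hullMor (hF : IsFrobenioid F) {A B : C} (f : A ⟶ B) : hullObj hF A ⟶ hullObj hF B :=
  ((isIsotropicHull_hullHom hF A).2.2.2 (f ≫ hullHom hF B) (isIsotropicHull_hullHom hF B).2.2.1).choose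

/-- The defining square of `hullMor`: `hull_A ≫ f^istr = f ≫ hull_B`.
[cite: MochizukiFrdI2008, Prop. 1.9(v) p.32] -/
theorem hullHom_hullMor (hF : IsFrobenioid F) {A B : C} (f : A ⟶ B) :
    hullHom hF A ≫ hullMor hF f = f ≫ hullHom hF B :=
  ((isIsotropicHull_hullHom hF A).2.2.2 (f ≫ hullHom hF B) (isIsotropicHull_hullHom hF B).2.2.1).choose_spec.1

/-- Uniqueness of the induced arrow. [cite: MochizukiFrdI2008, Prop. 1.9(v) p.32] -/
theorem hullMor_unique (hF : IsFrobenioid F) {A B : C} (f : A ⟶ B) {g : hullObj hF A ⟶ hullObj hF B}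
    (hg : hullHom hF A ≫ g = f ≫ hullHom hF B) : g = hullMor hF f :=
  ((isIsotropicHull_hullHom hF A).2.2.2 (f ≫ hullHom hF B) (isIsotropicHull_hullHom hF B).2.2.1).choose_spec.2 g hg

/-- **The isotropification functor** `C → C^istr`, `A ↦ A^istr`, `f ↦ f^istr`
(FrdI Prop. 1.9 (v)). [cite: MochizukiFrdI2008, Prop. 1.9(v) p.32] -/
noncomputable def isotropification (hF : IsFrobenioid F) : C ⥤ Istr F where
  obj A := hullIstr hF A
  map f := ObjectProperty.homMk (hullMor hF f)
  map_id A := by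
    apply ObjectProperty.hom_ext
    show hullMor hF (𝟙 A) = 𝟙 _
    symm; apply hullMor_unique
    rw [Category.comp_id, Category.id_comp]
  map_comp f g := by
    apply ObjectProperty.hom_ext
    show hullMor hF (f ≫ g) = hullMor hF f ≫ hullMor hF g
    symm; apply hullMor_unique
    rw [← Category.assoc, hullHom_hullMor, Category.assoc, hullHom_hullMor, Category.assoc]

/-- **Prop. 1.9 (v)**: the isotropification functor "forms a left adjoint to the inclusion functor
`C^istr ↪ C`" (the universal property of the hull). [cite: MochizukiFrdI2008, Prop. 1.9(v) p.32] -/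
noncomputable def isotropificationAdjunction (hF : IsFrobenioid F) :
    isotropification hF ⊣ (isotropicObjects F).ι :=
  Adjunction.mkOfHomEquiv
    { homEquiv := fun A X =>
        { toFun := fun g => hullHom hF A ≫ g.hom
          invFun := fun f => ObjectProperty.homMk
            ((isIsotropicHull_hullHom hF A).2.2.2 f X.property).choose
          left_inv := fun g => by
            apply ObjectProperty.hom_ext
            exact (((isIsotropicHull_hullHom hF A).2.2.2 (hullHom hF A ≫ g.hom) X.property).choose_spec.2
              g.hom rfl).symm
          right_inv := fun f =>
            ((isIsotropicHull_hullHom hF A).2.2.2 f X.property).choose_spec.1 }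
      homEquiv_naturality_left_symm := by
        intro A' A X f g
        apply ObjectProperty.hom_ext
        symm
        apply ((isIsotropicHull_hullHom hF A').2.2.2 (f ≫ g) X.property).choose_spec.2
        show hullHom hF A' ≫ hullMor hF f ≫ ((isIsotropicHull_hullHom hF A).2.2.2 g X.property).choose
          = f ≫ g
        rw [← Category.assoc, hullHom_hullMor, Category.assoc,
          ((isIsotropicHull_hullHom hF A).2.2.2 g X.property).choose_spec.1]
      homEquiv_naturality_right := by
        intro A X Y f g
        exact (Category.assoc _ _ _).symm }

/-- **Prop. 1.9 (v)**: the inclusion `C^istr ↪ C` is a right adjoint (reflective subcategory).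
[cite: MochizukiFrdI2008, Prop. 1.9(v) p.32] -/
theorem isRightAdjoint_istr_ι (hF : IsFrobenioid F) : ((isotropicObjects F).ι).IsRightAdjoint :=
  ⟨_, ⟨isotropificationAdjunction hF⟩⟩

/-- The image in `F_Φ` of an isotropic hull is an isomorphism (an isometric pre-step has invertible
base, trivial zero divisor and Frobenius degree one). [cite: MochizukiFrdI2008, Prop. 1.9(v) p.33] -/
theorem isIso_map_of_isIsometricPreStep {A B : C} {h : A ⟶ B} (hh : IsIsometricPreStep F h) :
    IsIso (F.map h) := by
  haveI : IsIso (ElemFrobenioid.Base (F.map h)) := hh.2.2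
  have hdiv : ElemFrobenioid.Div (F.map h) = 1 := hh.1
  have hdeg : ElemFrobenioid.degFr (F.map h) = 1 := hh.2.1
  refine ⟨⟨ElemFrobenioid.homMk (inv (ElemFrobenioid.Base (F.map h))) 1 1, ?_, ?_⟩⟩
  · refine ElemFrobenioid.Hom.ext ?_ ?_ ?_
    · show ElemFrobenioid.Base (F.map h) ≫ inv (ElemFrobenioid.Base (F.map h)) = 𝟙 _
      exact IsIso.hom_inv_id _
    · show pull Φ (ElemFrobenioid.Base (F.map h)) 1 * ElemFrobenioid.Div (F.map h) ^ ((1 : ℕ+) : ℕ) = 1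
      rw [map_one, hdiv, one_pow, mul_one]
    · show ElemFrobenioid.degFr (F.map h) * 1 = 1
      rw [hdeg, mul_one]
  · refine ElemFrobenioid.Hom.ext ?_ ?_ ?_
    · show inv (ElemFrobenioid.Base (F.map h)) ≫ ElemFrobenioid.Base (F.map h) = 𝟙 _
      exact IsIso.inv_hom_id _
    · show pull Φ (inv (ElemFrobenioid.Base (F.map h))) (ElemFrobenioid.Div (F.map h)) *
        1 ^ (ElemFrobenioid.degFr (F.map h) : ℕ) = 1
      rw [hdiv, map_one, one_pow, mul_one]
    · show 1 * ElemFrobenioid.degFr (F.map h) = 1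
      rw [hdeg, mul_one]

/-- **Prop. 1.9 (v)**: "through which the functor `C → F_Φ` factors": `F` is isomorphic to
isotropification followed by `C^istr → F_Φ`, via the images of the hulls.
[cite: MochizukiFrdI2008, Prop. 1.9(v) p.32] -/
noncomputable def isotropificationFactorsIso (hF : IsFrobenioid F) :
    F ≅ isotropification hF ⋙ istrFunctor F := by
  refine NatIso.ofComponents (fun A => (@asIso _ _ _ _ (F.map (hullHom hF A))
    (isIso_map_of_isIsometricPreStep
      ⟨(isIsotropicHull_hullHom hF A).1, (isIsotropicHull_hullHom hF A).2.1⟩) :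
      F.obj A ≅ F.obj (hullObj hF A))) ?_
  intro A B f
  show F.map f ≫ F.map (hullHom hF B) = F.map (hullHom hF A) ≫ F.map (hullMor hF f)
  rw [← F.map_comp, ← F.map_comp, hullHom_hullMor]

/-- **Prop. 1.9 (v)**: "The restriction of the isotropification functor to `C^istr` is isomorphic
to the identity functor" (the hull of an isotropic object is an isomorphism).
[cite: MochizukiFrdI2008, Prop. 1.9(v) p.32] -/
noncomputable def isotropificationRestrictIso (hF : IsFrobenioid F) :
    (isotropicObjects F).ι ⋙ isotropification hF ≅ 𝟭 (Istr F) := by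
  refine (NatIso.ofComponents (fun X => (isotropicObjects F).isoMk
    (@asIso _ _ _ _ (hullHom hF X.obj) (X.property (hullHom hF X.obj)
      (isIsotropicHull_hullHom hF X.obj).1 (isIsotropicHull_hullHom hF X.obj).2.1))) ?_).symm
  intro X Y f
  apply ObjectProperty.hom_ext
  exact (hullHom_hullMor hF f.hom).symm

/-! ### What the isotropification functor preserves -/

section Preserves

variable (hF : IsFrobenioid F) {A B : C} (f : A ⟶ B)

/-- `deg_Fr(f^istr) = deg_Fr(f)`: "preserves … Frobenius degrees" (Remark 1.1.1).
[cite: MochizukiFrdI2008, Prop. 1.9(v) p.32] -/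
theorem degFr_hullMor : degFr F (hullMor hF f) = degFr F f := by
  have h := congrArg (degFr F) (hullHom_hullMor hF f)
  rw [degFr_comp, degFr_comp, (isIsotropicHull_hullHom hF A).2.1.1,
    (isIsotropicHull_hullHom hF B).2.1.1, one_mul, mul_one] at h
  exact h

/-- `Div(f^istr) = (Base hull_A)⁻¹^* Div(f)` (Remark 1.1.1). [cite: MochizukiFrdI2008, Prop. 1.9(v) p.33] -/
theorem div_hullMor :
    haveI : IsIso (Base F (hullHom hF A)) := (isIsotropicHull_hullHom hF A).2.1.2
    Div F (hullMor hF f) = pull Φ (inv (Base F (hullHom hF A))) (Div F f) := by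
  haveI : IsIso (Base F (hullHom hF A)) := (isIsotropicHull_hullHom hF A).2.1.2
  have h := congrArg (Div F) (hullHom_hullMor hF f)
  rw [div_comp, div_comp, show Div F (hullHom hF A) = 1 from (isIsotropicHull_hullHom hF A).1,
    one_pow, mul_one, show Div F (hullHom hF B) = 1 from (isIsotropicHull_hullHom hF B).1, map_one,
    one_mul, show degFr F (hullHom hF B) = 1 from (isIsotropicHull_hullHom hF B).2.1.1, PNat.one_coe,
    pow_one] at h
  have := congrArg (pull Φ (inv (Base F (hullHom hF A)))) h
  rwa [← pull_comp, IsIso.inv_hom_id, pull_id] at this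

/-- `Base(f^istr) = (Base hull_A)⁻¹ ≫ Base(f) ≫ Base hull_B` (Remark 1.1.1).
[cite: MochizukiFrdI2008, Prop. 1.9(v) p.33] -/
theorem base_hullMor :
    haveI : IsIso (Base F (hullHom hF A)) := (isIsotropicHull_hullHom hF A).2.1.2
    Base F (hullMor hF f) = inv (Base F (hullHom hF A)) ≫ Base F f ≫ Base F (hullHom hF B) := by
  haveI : IsIso (Base F (hullHom hF A)) := (isIsotropicHull_hullHom hF A).2.1.2
  have h := congrArg (Base F) (hullHom_hullMor hF f)
  rw [base_comp, base_comp] at h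
  rw [IsIso.eq_inv_comp, h]

/-- Preserves isometries. [cite: MochizukiFrdI2008, Prop. 1.9(v) p.32] -/
theorem isIsometry_hullMor (h : IsIsometry F f) : IsIsometry F (hullMor hF f) := by
  show Div F (hullMor hF f) = 1
  rw [div_hullMor, show Div F f = 1 from h, map_one]

/-- Preserves linearity (Frobenius degrees). [cite: MochizukiFrdI2008, Prop. 1.9(v) p.32] -/
theorem isLinear_hullMor (h : IsLinear F f) : IsLinear F (hullMor hF f) := by
  show degFr F (hullMor hF f) = 1
  rw [degFr_hullMor]; exact h

/-- Preserves base-isomorphisms. [cite: MochizukiFrdI2008, Prop. 1.9(v) p.32] -/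
theorem isBaseIso_hullMor (h : IsBaseIso F f) : IsBaseIso F (hullMor hF f) := by
  haveI : IsIso (Base F (hullHom hF A)) := (isIsotropicHull_hullHom hF A).2.1.2
  haveI : IsIso (Base F (hullHom hF B)) := (isIsotropicHull_hullHom hF B).2.1.2
  haveI : IsIso (Base F f) := h
  show IsIso (Base F (hullMor hF f))
  rw [base_hullMor]
  infer_instance

/-- Preserves pre-steps. [cite: MochizukiFrdI2008, Prop. 1.9(v) p.32] -/
theorem isPreStep_hullMor (h : IsPreStep F f) : IsPreStep F (hullMor hF f) :=
  ⟨isLinear_hullMor hF f h.1, isBaseIso_hullMor hF f h.2⟩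

/-- Isomorphisms of `D` are FSM-morphisms. [cite: MochizukiFrdI2008, §0 p.14] -/
private theorem isFSM_of_isIso' {X Y : D} (g : X ⟶ Y) [IsIso g] : IsFSM g :=
  ⟨fun Z γ => ⟨Z, γ ≫ inv g, 𝟙 Z, by simp⟩, inferInstance⟩

/-- Preserves base-FSM-morphisms (composites of FSM-morphisms with isomorphisms are FSM).
[cite: MochizukiFrdI2008, Prop. 1.9(v) p.32] -/
theorem isBaseFSM_hullMor (h : IsBaseFSM F f) : IsBaseFSM F (hullMor hF f) := by
  haveI : IsIso (Base F (hullHom hF A)) := (isIsotropicHull_hullHom hF A).2.1.2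
  haveI : IsIso (Base F (hullHom hF B)) := (isIsotropicHull_hullHom hF B).2.1.2
  show IsFSM (Base F (hullMor hF f))
  rw [base_hullMor]
  exact IsFSM.comp (isFSM_of_isIso' _) (IsFSM.comp h (isFSM_of_isIso' _))

/-- Preserves co-angular morphisms: indeed EVERY arrow between the (isotropic) hulls is co-angular
("[cf. Proposition 1.4, (i)]"). [cite: MochizukiFrdI2008, Prop. 1.9(v) p.33] -/
theorem isCoAngular_hullMor : IsCoAngular F (hullMor hF f) :=
  isCoAngular_of_isIsotropic_codomains F _ (fun _ g => hF.vii_b g (isIsotropicHull_hullHom hF A).2.2.1)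

/-- Preserves LB-invertible morphisms. [cite: MochizukiFrdI2008, Prop. 1.9(v) p.32] -/
theorem isLBInvertible_hullMor (h : IsLBInvertible F f) : IsLBInvertible F (hullMor hF f) :=
  ⟨isCoAngular_hullMor hF f, isIsometry_hullMor hF f h.2⟩

/-- Preserves morphisms of Frobenius type. [cite: MochizukiFrdI2008, Prop. 1.9(v) p.32] -/
theorem isFrobeniusType_hullMor (h : IsFrobeniusType F f) : IsFrobeniusType F (hullMor hF f) :=
  ⟨isLBInvertible_hullMor hF f h.1, isBaseIso_hullMor hF f h.2⟩

/-- Preserves pull-back morphisms ("Since pull-back morphisms are co-angular linear isometries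
[cf. Proposition 1.4, (ii)] … maps pull-back morphisms to morphisms which are pull-back morphisms
relative to `C`, hence a fortiori … relative to `C^istr`").
[cite: MochizukiFrdI2008, Prop. 1.9(v) p.33] -/
theorem isPullbackMorphism_hullMor (h : IsPullbackMorphism F f) : IsPullbackMorphism F (hullMor hF f) := by
  obtain ⟨⟨-, hiso⟩, hlin⟩ := hF.iv_b f h
  exact (isPullbackMorphism_iff_isLBInvertible_isLinear F hF _).mpr
    ⟨⟨isCoAngular_hullMor hF f, isIsometry_hullMor hF f hiso⟩, isLinear_hullMor hF f hlin⟩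

/-- Preserves pull-back morphisms, relative to `C^istr`. [cite: MochizukiFrdI2008, Prop. 1.9(v) p.33] -/
theorem isPullbackMorphism_isotropification_map (h : IsPullbackMorphism F f) :
    IsPullbackMorphism (istrFunctor F) ((isotropification hF).map f) :=
  isPullbackMorphism_istr_of _ (isPullbackMorphism_hullMor hF f h)

end Preserves

/-- Preserves base-identity endomorphisms. [cite: MochizukiFrdI2008, Prop. 1.9(v) p.32] -/
theorem isBaseIdentity_hullMor (hF : IsFrobenioid F) {A : C} (f : A ⟶ A) (h : IsBaseIdentity F f) :
    IsBaseIdentity F (hullMor hF f) := by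
  haveI : IsIso (Base F (hullHom hF A)) := (isIsotropicHull_hullHom hF A).2.1.2
  show Base F (hullMor hF f) = 𝟙 _
  rw [base_hullMor, show Base F f = 𝟙 _ from h, Category.id_comp, IsIso.inv_hom_id]

/-- Preserves `Div`-identity endomorphisms. [cite: MochizukiFrdI2008, Prop. 1.9(v) p.32] -/
theorem isDivIdentity_hullMor (hF : IsFrobenioid F) {A : C} (f : A ⟶ A) (h : IsDivIdentity F f) :
    IsDivIdentity F (hullMor hF f) := by
  haveI : IsIso (Base F (hullHom hF A)) := (isIsotropicHull_hullHom hF A).2.1.2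
  show pull Φ (Base F (hullMor hF f)) = MonoidHom.id _
  ext x
  rw [base_hullMor, pull_comp, pull_comp, show pull Φ (Base F f) = MonoidHom.id _ from h,
    MonoidHom.id_apply, ← pull_comp, IsIso.inv_hom_id, pull_id, MonoidHom.id_apply]

end PreFrobenioid

end Literature.AlgebraicGeometry.Frobenioids
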